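import Summits.AtomisticToContinuum.Crystallization.Theorems.FreeSplittingCertificatesRadiusLadderCritical
import Summits.AtomisticToContinuum.Crystallization.Theorems.FreeSplittingCertificatesRadiusLadderHalfRule65

/-!
# `FiniteRangeSplitting` (stmt-AtomisticToContinuum-12559): the critical hard core lies in `[0, 6/5]`

Support file for crux r2 of route `FreeSplittingCertificates` (block-2b unit `b2b-freesplit-A`, gen 14).
VALUE = theorems bracketing the crux — NOT summit progress.

Numeric corollaries of `…RadiusLadderCritical` (the critical hard core `critSep = δ_c`, the attained half-rule threshold
`halfSumThreshold = δ_½`) with the tree certificates `47/50 ≤ δ_½ ≤ 6/5` (`Star902`; the degree-`7` Delsarte layer cake of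
`…RadiusLadderHalfRule65`):

* `critSep_le_six_fifths`, `critSep_mem_Icc_six_fifths` : `δ_c ∈ [0, 6/5]`;
* `halfSumFeasible_decided65` : the deepest-site inequality is TRUE on `[6/5, ∞)`, FALSE on `(-∞, 47/50]`, and on the gap
  `(47/50, 6/5)` it is the closed condition `δ_½ ≤ δ` for ONE real number `δ_½ ∈ [47/50, 6/5]`;
* `finiteRangeSplitting_iff_window65` : crux r2 ⟺ for every hard core `δ ∈ (0, 6/5)` there is a rung of radius `R ≥ δ`,
  with `R ≥ 47/50` forced whenever `δ ≤ 47/50` (`not_rungAt_47_50`).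
-/

noncomputable section

namespace Summit.AtomisticToContinuum.Crystallization.Theorems.StrictSplittingRuleBirth

open scoped BigOperators Classical
open Literature.MathematicalPhysics.StatisticalMechanics

/-- `δ_c ≤ 6/5`. -/
theorem critSep_le_six_fifths : critSep ≤ 6 / 5 :=
  critSep_le_halfSumThreshold.trans halfSumThreshold_le_six_fifths

/-- **The certified bracket of the critical hard core**: `δ_c ∈ [0, 6/5]`. -/
theorem critSep_mem_Icc_six_fifths : critSep ∈ Set.Icc (0 : ℝ) (6 / 5) :=
  ⟨critSep_nonneg, critSep_le_six_fifths⟩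

/-- `6/5 ∈ RungSet` (indeed every `δ ≥ 6/5`). -/
theorem mem_rungSet_of_six_fifths_le {δ : ℝ} (h : 6 / 5 ≤ δ) : δ ∈ RungSet :=
  mem_rungSet_of_threshold_le (halfSumThreshold_le_six_fifths.trans h)

/-- **The deepest-site inequality, decided outside `(47/50, 6/5)` and closed inside**: TRUE for `δ ≥ 6/5`, FALSE for
`δ ≤ 47/50`, and equal to `δ_½ ≤ δ` with `δ_½ ∈ [47/50, 6/5]` everywhere. -/
theorem halfSumFeasible_decided65 (δ : ℝ) :
    (6 / 5 ≤ δ → HalfSumFeasible δ) ∧ (δ ≤ 47 / 50 → ¬ HalfSumFeasible δ) ∧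
      (HalfSumFeasible δ ↔ halfSumThreshold ≤ δ) ∧ halfSumThreshold ∈ Set.Icc ((47 : ℝ) / 50) (6 / 5) :=
  ⟨halfSumFeasible_of_six_fifths_le, not_halfSumFeasible_of_le_47_50, halfSumFeasible_iff_threshold_le,
    halfSumThreshold_mem_Icc_47_50_6_5⟩

/-- **The window form of crux r2 with the tree certificates**: it suffices (and is necessary) to find, for every hard
core `δ ∈ (0, 6/5)`, a rung of radius `R ≥ δ` — and of radius `R ≥ 47/50` whenever `δ ≤ 47/50`. -/
theorem finiteRangeSplitting_iff_window65 :
    Summit.AtomisticToContinuum.Crystallization.Theses.FreeSplittingCertificates.FiniteRangeSplitting ↔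
      ∀ δ : ℝ, 0 < δ → δ < 6 / 5 → ∃ R : ℝ, δ ≤ R ∧ (δ ≤ 47 / 50 → 47 / 50 ≤ R) ∧ RungAt δ R := by
  rw [finiteRangeSplitting_iff_below (mem_rungSet_of_six_fifths_le le_rfl)]
  refine forall₂_congr fun δ hδ => forall_congr' fun _ => ⟨?_, ?_⟩
  · rintro ⟨R, -, hr⟩
    have hr' : RungAt δ (max R δ) := rungAt_mono_radius (le_max_left R δ) hr
    exact ⟨max R δ, le_max_right R δ,
      fun h47 => not_lt.mp fun hlt' => not_rungAt_47_50 δ _ h47 hlt' hr', hr'⟩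
  · rintro ⟨R, hR, -, hr⟩
    exact ⟨R, hδ.trans_le hR, hr⟩

/-- The `ε`-critical hard cores are in `[0, 6/5]` too (`ε ≥ 0`). -/
theorem critSepApprox_mem_Icc_six_fifths {ε : ℝ} (hε : 0 ≤ ε) : critSepApprox ε ∈ Set.Icc (0 : ℝ) (6 / 5) :=
  ⟨critSepApprox_nonneg hε, (critSepApprox_le_critSep hε).trans critSep_le_six_fifths⟩

end Summit.AtomisticToContinuum.Crystallization.Theorems.StrictSplittingRuleBirth

end
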